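import Literature.IUT.LogThetaLattice.TimesMuSideOfStrips
import Literature.IUT.HodgeArakelov.RealifiedPrimeStripSplitRigidity

/-!
# [IUTchII] Def 4.9 (viii) / Cor 4.6 (ii) on the REAL frame of record: over a DEGREE-CLASSIFIED model strip,
# `F^{⊩▶×μ} ↦ F^{⊢▶×μ}` is INJECTIVE on isomorphisms in `TimesMuSide.ofPassages` and in `StripFrame.ofKits`

Proof-only sequel (abc-iut cell, layer L6; abc-iut-L6-t22 gen 10; 0 definitions) of
`HodgeArakelov/RealifiedPrimeStripSplitRigidity(Component).lean` (rigidity of the global component of a morphism of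
print-level `F^{⊩▶×μ}`-prime-strips at degree-classified strips; disposition of D-L6t22-R9F1a ratified L6-lead §F v1.19i (1))
in the currency of abc-iut-L6-t3's `TimesMuSideOfStrips.lean`: the [IUTchII] Def 4.9 input `TimesMuSide.ofPassages L hR Ps`
of the frame `StripFrame.ofKits` (prime-strip / Hodge-theater frame of [IUTchIII] §1–§2 assembled from abc-iut-L5-t4's
[IUTchI] kits), whose `F^{⊩▶×μ}`-prime-strips are pairs (`𝒟^⊢`-prime-strip of `ℱ`-type, isomorph of the model `S₀` in
abc-iut-L6-t2's groupoid `FVdashSplitTriMuPrimeStrip`) and whose `F^{⊩▶×μ} ↦ F^{⊢▶×μ}` is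
`(𝟭 _).prod (Isomorphs.mapAlong toSplitStripFunctor)`.

PRINT. [IUTchII] Def 4.9 (viii) p. 158 «`*F^{⊩▶×μ} = (*C^⊩, Prime(*C^⊩) ⥲ V, *F^{⊢▶×μ}, {*ρ_v}_{v∈V})` … A morphism of
`F^{⊩▶×μ}`-prime-strips is defined to be an isomorphism between collections of data»; Cor 4.6 (ii) p. 138 «an
isomorphism of Frobenioids … uniquely determined by the condition that it be compatible with the respective bijections
`Prime(−) ⥲ V̲` and local isomorphisms»; [IUTchI] Def 5.2 (iv)(f) p. 135 «isomorphic to the collection of data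
`𝔉^⊩_mod`»; [FrdI] Thm 6.4 (i) p. 114 «`δ_A : Pic_Φ(A) ⥲ ℝ`». [claim: Mochizuki2012, status: disputed] for the IUT sentences.

WHAT IS PROVED (elementary; the one hypothesis is the MODEL CONDITION (c′) «`S₀.data.realifiedF.degClass` injective», i.e.
the model strip's `*C^⊩` is degree-classified — witnessed at the genuine number-field model by abc-iut-L6-t22's
`GlobalLGPFrobenioidsRealifiedDegClassified.lean`, and inherited by every isomorph of `S₀`, `Isomorphs.degClass_injective`):
* `Isomorphs.faithful_mapAlong_toSplitStrip` — `Isomorphs.mapAlong toSplitStripFunctor : Isomorphs S₀ ⥤ Isomorphs (modelVt S₀)`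
  is FAITHFUL; `Isomorphs.mapIso_toSplitStrip_injective` (iso form);
* **`TimesMuSide.ofPassages_mapIso_fglxmToFvtxm_injective`** — in the instance `TimesMuSide.ofPassages L hR Ps`,
  `F^{⊩▶×μ} ↦ F^{⊢▶×μ}` is INJECTIVE on `Isom(A, B)` for all `A`, `B`;
* **`StripFrame.ofPassages_mapIso_fglxmToFvtxm_injective`** — the same on the assembled frame
  `StripFrame.ofKits L hbij hsurj hR (TimesMuSide.ofPassages L hR Ps)` (transport along `AsSmall`, `liftF_mapIso_injective`).
So on the real frame of record the «larger automorphism groups» risk named in finding R9-F1 / O7-F1 (rigidity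
instantiation of [IUTchII] Cor 4.10 (v) / [IUTchIII] Thm 1.5 (v)) is ABSENT whenever the model strip satisfies print's
classification — the INJECTIVE companion of abc-iut-L6-t3's SURJECTIVITY `TimesMuSide.ofPassages_mapIso_surjective`
(onto `F^{⊢×μ}`, [IUTchII] Cor 4.10 (iv)). HONEST FRAMING: bookkeeping over the cell's typed records; nothing here asserts
a disputed claim or takes a side on [IUTchIII] Cor 3.12; typed ≠ proved for every interface-level statement upstream.
-/

namespace Literature.IUT.LogThetaLattice

open CategoryTheory
open Literature.IUT.HodgeTheaters Literature.IUT.HodgeTheaters.PMBaseKit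
open Literature.IUT.HodgeArakelov

universe u u' v w

/-! ### §0 Transport of injectivity on isomorphisms along `AsSmall` -/

namespace AsSmallTransport

variable {C : Type u} [Category.{v} C] {D : Type u'} [Category.{w} D]

/-- **IUTchII:Cor4.6(ii)** (kurims p.138) Injectivity of `mapIso` on isomorphisms transfers to the small models (companion of
abc-iut-L6-t3's `liftF_mapIso_bijective` / `liftF_mapIso_surjective`). [claim: Mochizuki2012, status: disputed] -/
theorem liftF_mapIso_injective (Φ : C ⥤ D)
    (h : ∀ X Y : C, Function.Injective (fun g : X ≅ Y => Φ.mapIso g)) (X Y : AsSmall.{w} C) :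
    Function.Injective (fun f : X ≅ Y => (liftF Φ).mapIso f) := by
  rw [liftF_mapIso_eq]
  exact (isoEquiv _ _).symm.injective.comp ((h _ _).comp (isoEquiv X Y).injective)

end AsSmallTransport

/-! ### §1 Isomorphs of a degree-classified model strip -/

namespace Isomorphs

variable {V : Type u} {P : PlaceData V} {G : V → Type u} [∀ v, Group (G v)]
  {X : ∀ v, GroupTheoreticUnits.{u, w} (G v)} {S₀ : FVdashSplitTriMuPrimeStrip.{u, v, w} P G X}

/-- **IUTchI:Def5.2(iv)** (kurims p.135) «isomorphic to `𝔉^⊩_mod`»: every isomorph of a DEGREE-CLASSIFIED model strip is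
degree-classified (cf. abc-iut-L6-t22's `FVdashSplitTriMuPrimeStrip.degClass_injective_iff_of_hom`, `RealifiedPrimeStripSplitRigidityComponent.lean`). [claim: Mochizuki2012, status: disputed] -/
theorem degClass_injective (hS₀ : Function.Injective S₀.data.realifiedF.degClass) (A : Isomorphs S₀) :
    Function.Injective A.obj.data.realifiedF.degClass := by
  obtain ⟨e⟩ := A.isModel
  have hcomp : S₀.data.realifiedF.degClass ∘ e.hom.classEquiv = A.obj.data.realifiedF.degClass :=
    funext e.hom.degClass_eq
  rw [← hcomp]
  exact hS₀.comp e.hom.classEquiv.injective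

/-- **IUTchII:Cor4.6(ii)** (kurims p.138) «uniquely determined by … local isomorphisms»: over a degree-classified model strip,
`F^{⊩▶×μ} ↦ F^{⊢▶×μ}` on the isomorphs (`Isomorphs.mapAlong toSplitStripFunctor`) is FAITHFUL.
[claim: Mochizuki2012, status: disputed] -/
theorem faithful_mapAlong_toSplitStrip (hS₀ : Function.Injective S₀.data.realifiedF.degClass) :
    (Isomorphs.mapAlong (M₀ := S₀) FVdashSplitTriMuPrimeStrip.toSplitStripFunctor).Faithful :=
  ⟨fun {_ B} _ _ h => FVdashSplitTriMuPrimeStrip.Hom.ext_of_locSplitIso_eq (degClass_injective hS₀ B) h⟩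

/-- **IUTchII:Cor4.6(ii)** (kurims p.138) … hence INJECTIVE on `Isom(A, B)` for all isomorphs `A`, `B` of the model.
[claim: Mochizuki2012, status: disputed] -/
theorem mapIso_toSplitStrip_injective (hS₀ : Function.Injective S₀.data.realifiedF.degClass) (A B : Isomorphs S₀) :
    Function.Injective (fun e : A ≅ B =>
      (Isomorphs.mapAlong (M₀ := S₀) FVdashSplitTriMuPrimeStrip.toSplitStripFunctor).mapIso e) := by
  haveI := faithful_mapAlong_toSplitStrip hS₀
  intro e e' h
  exact Iso.ext ((Isomorphs.mapAlong (M₀ := S₀) FVdashSplitTriMuPrimeStrip.toSplitStripFunctor).map_injective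
    (congrArg Iso.hom h))

end Isomorphs

/-! ### §2 The instance `TimesMuSide.ofPassages` and the assembled frame `StripFrame.ofKits` -/

section OfPassages

variable {l : ℕ} {K : PMBaseKit.{max (v + 1) w} l} {M : K.MultKit} {FK : K.FKit M}
  {P : PlaceData K.V} {G : K.V → Type} [∀ v, Group (G v)]
  {X : ∀ v, GroupTheoreticUnits.{0, w} (G v)} {S₀ : FVdashSplitTriMuPrimeStrip.{0, v, w} P G X}
  (L : FK.MonoLaws) (hbij : FK.IsomFtoDBijective) (hsurj : FK.IsomFmtoDmSurjective)
  (hR : FK.RlfOfIsStrip) (Ps : TimesMuPassages FK S₀)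

/-- **IUTchII:Cor4.6(ii)** (kurims p.138) In the instance `TimesMuSide.ofPassages L hR Ps` over a DEGREE-CLASSIFIED model strip `S₀`,
`F^{⊩▶×μ} ↦ F^{⊢▶×μ}` is INJECTIVE on `Isom(A, B)` for all `A`, `B`: an isomorphism of `F^{⊩▶×μ}`-prime-strips of the frame is
determined by the induced isomorphism of `F^{⊢▶×μ}`-prime-strips (`𝒟^⊢`-component unchanged, `×μ`/`▶`-component by
`Hom.ext_of_locSplitIso_eq`). [claim: Mochizuki2012, status: disputed] -/
theorem TimesMuSide.ofPassages_mapIso_fglxmToFvtxm_injective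
    (hS₀ : Function.Injective S₀.data.realifiedF.degClass) (A B : (TimesMuSide.ofPassages L hR Ps).Fglxm) :
    Function.Injective (fun g : A ≅ B => (TimesMuSide.ofPassages L hR Ps).FglxmToFvtxm.mapIso g) := by
  intro g g' h
  have hh : (TimesMuSide.ofPassages L hR Ps).FglxmToFvtxm.map g.hom =
      (TimesMuSide.ofPassages L hR Ps).FglxmToFvtxm.map g'.hom := congrArg Iso.hom h
  obtain ⟨h1, h2⟩ := Prod.ext_iff.mp hh
  refine Iso.ext (Prod.ext h1 ?_)
  exact FVdashSplitTriMuPrimeStrip.Hom.ext_of_locSplitIso_eq (Isomorphs.degClass_injective hS₀ B.2) h2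

/-- **IUTchII:Cor4.6(ii)** (kurims p.138) On the ASSEMBLED FRAME `StripFrame.ofKits L hbij hsurj hR (TimesMuSide.ofPassages L hR Ps)`
([IUTchIII] §1–§2 frame of record over the [IUTchI] kits and the print-level [IUTchII] Def 4.9 groupoids) over a
DEGREE-CLASSIFIED model strip, `Isom_{F^{⊩▶×μ}}(A, B) → Isom_{F^{⊢▶×μ}}` is INJECTIVE for all `A`, `B` — the injective
companion of abc-iut-L6-t3's `StripFrame.ofPassages_map_full_fglxmToFxm` (surjective onto `F^{⊢×μ}`, [IUTchII] Cor 4.10 (iv)).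
[claim: Mochizuki2012, status: disputed] -/
theorem StripFrame.ofPassages_mapIso_fglxmToFvtxm_injective
    (hS₀ : Function.Injective S₀.data.realifiedF.degClass)
    (A B : (StripFrame.ofKits L hbij hsurj hR (TimesMuSide.ofPassages L hR Ps)).Fglxm) :
    Function.Injective (fun f : A ≅ B =>
      (StripFrame.ofKits L hbij hsurj hR (TimesMuSide.ofPassages L hR Ps)).FglxmToFvtxm.mapIso f) :=
  AsSmallTransport.liftF_mapIso_injective _
    (TimesMuSide.ofPassages_mapIso_fglxmToFvtxm_injective L hR Ps hS₀) A B

/-- Hence, on the assembled frame over a degree-classified model strip, an AUTOMORPHISM of an `F^{⊩▶×μ}`-prime-strip inducing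
the identity on its `F^{⊢▶×μ}`-prime-strip is the identity (no «extra automorphisms» of the R9-F1 kind on the frame of
record). [claim: Mochizuki2012, status: disputed] -/
theorem StripFrame.ofPassages_aut_eq_refl_of_fglxmToFvtxm
    (hS₀ : Function.Injective S₀.data.realifiedF.degClass)
    (A : (StripFrame.ofKits L hbij hsurj hR (TimesMuSide.ofPassages L hR Ps)).Fglxm) (f : A ≅ A)
    (h : (StripFrame.ofKits L hbij hsurj hR (TimesMuSide.ofPassages L hR Ps)).FglxmToFvtxm.mapIso f = Iso.refl _) :
    f = Iso.refl A :=
  StripFrame.ofPassages_mapIso_fglxmToFvtxm_injective L hbij hsurj hR Ps hS₀ A A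
    (h.trans (Functor.mapIso_refl _ _).symm)

end OfPassages

end Literature.IUT.LogThetaLattice
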